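import Mathlib
import Literature.Analysis.FluidPDE.ESSUniqueContinuationHolds
import Literature.Analysis.FluidPDE.HarmonicMeanValue
import Literature.Analysis.FluidPDE.LocalTypeI
import Summits.NavierStokesRegularity.NavierStokesRegularity.Theorems.RootDecompLitSliceDarkBallSpreadsNullSetComplementConnected
import Summits.NavierStokesRegularity.NavierStokesRegularity.Theorems.RootDecompLitSliceDarkBallSpreadsComplConnected
import HarnessLib

/-!
# Route RootDecompLitSlice — brick B6′ of the aside D₁ `DarkBallSpreads`
  (stmt-NavierStokesRegularity-29566, registered stub `stub_darkBallSpreads` of crux D `NoDarkBall`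
  stmt-NavierStokesRegularity-29563): **static unique continuation — a harmonic field on the
  connected regular region vanishing near one point vanishes on the whole region, hence a.e.**

The census ledger (row E20) closes the "dark ball spreads" theorem D₁ by: B0 `ℋ¹(Σ_T) = 0`
(landed), B1–B3 smoothness / identification / flatness of the terminal slice off `Σ_T`, B4 = the
tree's ESS unique continuation (`ess_unique_continuation_holds`) giving `curl u(T) ≡ 0` on the
connected (B5, landed) regular region `ℝ³ \ Σ_T`, then **B6 (capacitary removability of the `H⁻¹`
curl across the `2`-capacity-null set `Σ_T`) + Weyl + B7 (`L²` Liouville)** to conclude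
`u(T) = 0` a.e.

This file REPLACES the B6 + Weyl + B7 tail by an elementary static argument that needs no capacity,
no `L²` hypothesis and no Liouville theorem: once the terminal slice `w = u(T)` is `C²` with
`Δ w = 0` on the open connected set `Ω = ℝ³ \ Σ_T` (from `curl w = 0`, `div w = 0` there) and
vanishes a.e. on a dark ball, it vanishes on all of `Ω` by **unique continuation for harmonic
functions**, obtained here from the tree's PROVED parabolic unique continuation
`Literature.Analysis.FluidPDE.ess_unique_continuation_holds` (Escauriaza–Seregin–Šverák 2003,
Thm. 4.1) applied to the time-independent field `u(t, y) = w(a + y)` with `c₁ = 0`: vanishing on a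
small ball plus boundedness is vanishing of infinite parabolic order. Since `Σ_T` is Lebesgue-null
(`ℋ³ ≤ ℋ¹`, Haar comparison), `w = 0` a.e. on `ℝ³`; an a.e.-representative `v` (`v = w` a.e. off
`Σ_T`, the D₁ slice `u T`) is then `0` a.e. as well.

Main results (`ℝ³ = EuclideanSpace ℝ (Fin 3)`, values in `EuclideanSpace ℝ (Fin m)`):
* `eqOn_zero_ball_of_laplacian_eq_zero` — `C²` on `B(a, R₀)`, `Δ f = 0` there, `f = 0` on
  `B(a, δ)` ⟹ `f = 0` on `B(a, R₀)` (ESS Thm 4.1, static case);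
* `eqOn_zero_of_laplacian_eq_zero_of_isPreconnected` — identity theorem on an open preconnected
  set (open–closed argument);
* `volume_eq_zero_of_hausdorffMeasure_one_eq_zero` — `ℋ¹`-null ⟹ Lebesgue-null in `ℝ³`;
* `eqOn_zero_compl_of_laplacian_eq_zero_of_darkBall`,
  `ae_eq_zero_of_laplacian_eq_zero_off_closed_null_of_darkBall`,
  `ae_eq_zero_of_ae_eq_harmonic_off_closed_null_of_darkBall` — the D₁-facing forms: `Σ` closed
  `ℋ¹`-null, `w` harmonic (`C²`, `Δ w = 0`) on `Σᶜ`, `w` (resp. an a.e.-representative `v`) zero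
  a.e. on a ball ⟹ `w = 0` on `Σᶜ` and `w = 0` (resp. `v = 0`) a.e.;
* `ae_eq_zero_of_ae_eq_harmonic_off_backwardSingularSlice_of_darkBall` — the same with
  `Σ = Σ_t = {x | IsBackwardSingularPoint u (t, x)}` (closed by `isClosed_backwardSingularSlice`,
  nullity as hypothesis — brick B0 for the terminal slice of the Clay-class solutions of D₁).

HONEST FRAMING: elementary given the tree's ESS theorem; closes no item by itself (B1–B3 and the
assembly remain with the census instrument); nothing here bears on NS regularity (rung 0).
Lands `--supports stmt-NavierStokesRegularity-29566` (decomp-ns route-writer g15).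

Sources: Escauriaza–Seregin–Šverák 2003 Thm 4.1 / Seregin 2014 App. A.2 (tree, proved);
unique continuation of harmonic functions: Axler–Bourdon–Ramey 2001, Thm 1.27; the tree notes
(`HarmonicAnalyticContinuation.lean`) that Mathlib has harmonic ⇒ analytic only in the plane.
-/

set_option linter.dupNamespace false
set_option linter.style.longLine false

noncomputable section

open MeasureTheory Set Metric Filter Topology Function Module
open scoped ENNReal Laplacian
open Literature.Analysis.FluidPDE

namespace Summit.NavierStokesRegularity.NavierStokesRegularity.Theorems

/-! ## Unique continuation for harmonic functions from the tree's ESS theorem -/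

section HUC

variable {m : ℕ}

/-- **Harmonic unique continuation on a ball (static case of ESS 2003, Thm 4.1).** If
`f : ℝ³ → ℝᵐ` is `C²` on the open ball `B(a, R₀)` with `Δ f = 0` there and `f = 0` on a smaller
concentric ball `B(a, δ)`, `δ > 0`, then `f = 0` on `B(a, R₀)`: the time-independent field
`u(t, y) = f(a + y)` satisfies `|∂ₜu + Δu| = 0 ≤ 0 · (|u| + |∇u|)` on `]0,1[ × B(R')` for every
`R' < R₀`, is bounded there, and vanishes for `|y| < δ`, hence `|u| ≤ (M/δᵏ)(|y| + √t)ᵏ` for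
every `k`; `ess_unique_continuation_holds` gives `u(0, ·) = 0` on `B(R')`.
[cite: EscauriazaSereginSverak2003, Thm. 4.1] [cite: AxlerBourdonRamey2001, Thm 1.27] -/
theorem eqOn_zero_ball_of_laplacian_eq_zero
    {f : EuclideanSpace ℝ (Fin 3) → EuclideanSpace ℝ (Fin m)} {a : EuclideanSpace ℝ (Fin 3)}
    {R₀ δ : ℝ} (hf : ContDiffOn ℝ 2 f (ball a R₀)) (hΔ : ∀ x ∈ ball a R₀, (Δ f) x = 0)
    (hδ : 0 < δ) (h0 : ∀ x ∈ ball a δ, f x = 0) :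
    ∀ x ∈ ball a R₀, f x = 0 := by
  intro x hx
  obtain ⟨R', hxR', hR'R₀⟩ := exists_between (mem_ball.1 hx)
  have hR' : 0 < R' := dist_nonneg.trans_lt hxR'
  -- the translated field `g y = f (a + y)` and the static space–time field `u t y = g y`
  set g : EuclideanSpace ℝ (Fin 3) → EuclideanSpace ℝ (Fin m) := fun y => f (a + y) with hg_def
  set u : ℝ → EuclideanSpace ℝ (Fin 3) → EuclideanSpace ℝ (Fin m) := fun _ y => g y with hu_def
  have hmaps : ∀ y ∈ ball (0 : EuclideanSpace ℝ (Fin 3)) R₀, a + y ∈ ball a R₀ := by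
    intro y hy
    rwa [mem_ball, dist_eq_norm, add_sub_cancel_left, ← mem_ball_zero_iff]
  have hg : ContDiffOn ℝ 2 g (ball 0 R₀) :=
    hf.comp (contDiff_const.add contDiff_id).contDiffOn (fun y hy => hmaps y hy)
  have hsubR' : closedBall (0 : EuclideanSpace ℝ (Fin 3)) R' ⊆ ball 0 R₀ :=
    closedBall_subset_ball hR'R₀
  have hballR' : ball (0 : EuclideanSpace ℝ (Fin 3)) R' ⊆ ball 0 R₀ :=
    ball_subset_closedBall.trans hsubR'
  -- continuity of `g`, `∇g`, `∇²g` on the open ball `B(0, R₀)`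
  have hgc : ContinuousOn g (ball 0 R₀) := hg.continuousOn
  have hg1 : ContinuousOn (fderiv ℝ g) (ball 0 R₀) :=
    hg.continuousOn_fderiv_of_isOpen isOpen_ball (by norm_num)
  have hg2 : ContinuousOn (iteratedFDeriv ℝ 2 g) (ball 0 R₀) :=
    (hg.continuousOn_iteratedFDerivWithin le_rfl isOpen_ball.uniqueDiffOn).congr
      (fun y hy => (iteratedFDerivWithin_of_isOpen 2 isOpen_ball hy).symm)
  -- bounds on the compact ball `B̄(0, R')`
  obtain ⟨C₀, hC₀⟩ := (isCompact_closedBall (0 : EuclideanSpace ℝ (Fin 3)) R').exists_bound_of_continuousOn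
    (hgc.mono hsubR')
  obtain ⟨C₁, hC₁⟩ := (isCompact_closedBall (0 : EuclideanSpace ℝ (Fin 3)) R').exists_bound_of_continuousOn
    (hg1.mono hsubR')
  obtain ⟨C₂, hC₂⟩ := (isCompact_closedBall (0 : EuclideanSpace ℝ (Fin 3)) R').exists_bound_of_continuousOn
    (hg2.mono hsubR')
  -- the time derivative of the static field vanishes
  have htime : ∀ t y, timeDeriv u t y = 0 := by
    intro t y
    simp [timeDeriv_apply, hu_def]
  -- the Laplacian of the translated field
  have hΔg : ∀ y ∈ ball (0 : EuclideanSpace ℝ (Fin 3)) R₀, (Δ g) y = 0 := by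
    intro y hy
    rw [hg_def, laplacian_comp_const_add f a y]
    exact hΔ _ (hmaps y hy)
  -- (H1) joint `C²` regularity on the open cylinder
  have H1 : ContDiffOn ℝ 2 (uncurry u) (Ioo (0 : ℝ) 1 ×ˢ ball (0 : EuclideanSpace ℝ (Fin 3)) R') := by
    have : uncurry u = fun z : ℝ × EuclideanSpace ℝ (Fin 3) => g z.2 := rfl
    rw [this]
    exact hg.comp contDiff_snd.contDiffOn (fun z hz => hballR' hz.2)
  -- (H2) continuity up to the initial slice
  have H2 : ContinuousOn (uncurry u) (Ico (0 : ℝ) 1 ×ˢ ball (0 : EuclideanSpace ℝ (Fin 3)) R') := by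
    have : uncurry u = fun z : ℝ × EuclideanSpace ℝ (Fin 3) => g z.2 := rfl
    rw [this]
    exact hgc.comp continuous_snd.continuousOn (fun z hz => hballR' hz.2)
  -- (H3) the `W^{2,1}_2` integrability (bounded integrand on a bounded cylinder)
  have H3 : (∫⁻ z in Ioo (0 : ℝ) 1 ×ˢ ball (0 : EuclideanSpace ℝ (Fin 3)) R',
      (‖u z.1 z.2‖ₑ ^ 2 + ‖fderiv ℝ (u z.1) z.2‖ₑ ^ 2 + ‖iteratedFDeriv ℝ 2 (u z.1) z.2‖ₑ ^ 2 +
        ‖timeDeriv u z.1 z.2‖ₑ ^ 2)) < ∞ := by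
    set K : ℝ≥0∞ := ENNReal.ofReal C₀ ^ 2 + ENNReal.ofReal C₁ ^ 2 + ENNReal.ofReal C₂ ^ 2 + 0
      with hK
    have hbound : ∀ z ∈ Ioo (0 : ℝ) 1 ×ˢ ball (0 : EuclideanSpace ℝ (Fin 3)) R',
        (‖u z.1 z.2‖ₑ ^ 2 + ‖fderiv ℝ (u z.1) z.2‖ₑ ^ 2 + ‖iteratedFDeriv ℝ 2 (u z.1) z.2‖ₑ ^ 2 +
          ‖timeDeriv u z.1 z.2‖ₑ ^ 2) ≤ K := by
      intro z hz
      have hy : z.2 ∈ closedBall (0 : EuclideanSpace ℝ (Fin 3)) R' := ball_subset_closedBall hz.2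
      have e0 : ‖u z.1 z.2‖ₑ ≤ ENNReal.ofReal C₀ := by
        rw [← ofReal_norm]; exact ENNReal.ofReal_le_ofReal (hC₀ _ hy)
      have e1 : ‖fderiv ℝ (u z.1) z.2‖ₑ ≤ ENNReal.ofReal C₁ := by
        rw [← ofReal_norm]; exact ENNReal.ofReal_le_ofReal (hC₁ _ hy)
      have e2 : ‖iteratedFDeriv ℝ 2 (u z.1) z.2‖ₑ ≤ ENNReal.ofReal C₂ := by
        rw [← ofReal_norm]; exact ENNReal.ofReal_le_ofReal (hC₂ _ hy)
      have e3 : ‖timeDeriv u z.1 z.2‖ₑ ^ 2 = 0 := by rw [htime]; simp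
      rw [e3, hK]
      gcongr
    have hvol : volume (Ioo (0 : ℝ) 1 ×ˢ ball (0 : EuclideanSpace ℝ (Fin 3)) R') < ∞ :=
      ((Metric.isBounded_Ioo (0 : ℝ) 1).prod isBounded_ball).measure_lt_top
    refine lt_of_le_of_lt (setLIntegral_mono measurable_const hbound) ?_
    rw [setLIntegral_const]
    refine ENNReal.mul_lt_top ?_ hvol
    simp [hK, ENNReal.add_lt_top, ENNReal.pow_lt_top ENNReal.ofReal_lt_top]
  -- (H4) the differential inequality with `c₁ = 0`
  have H4 : ∀ t ∈ Ioo (0 : ℝ) 1, ∀ y ∈ ball (0 : EuclideanSpace ℝ (Fin 3)) R',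
      ‖timeDeriv u t y + Δ (u t) y‖ ≤ 0 * (‖u t y‖ + ‖fderiv ℝ (u t) y‖) := by
    intro t _ y hy
    have : Δ (u t) y = 0 := by
      show (Δ g) y = 0
      exact hΔg y (hballR' hy)
    rw [htime, this, add_zero, norm_zero, zero_mul]
  -- (H5) vanishing of infinite order at the origin
  have H5 : ∀ k : ℕ, ∃ C : ℝ, ∀ t ∈ Ioo (0 : ℝ) 1, ∀ y ∈ ball (0 : EuclideanSpace ℝ (Fin 3)) R',
      ‖u t y‖ ≤ C * (‖y‖ + Real.sqrt t) ^ k := by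
    intro k
    set M : ℝ := max C₀ 0 with hM
    have hM0 : 0 ≤ M := le_max_right _ _
    refine ⟨M / δ ^ k, fun t _ y hy => ?_⟩
    have hδk : 0 < δ ^ k := pow_pos hδ k
    by_cases hyδ : ‖y‖ < δ
    · have hzero : u t y = 0 := by
        show f (a + y) = 0
        apply h0
        rwa [mem_ball, dist_eq_norm, add_sub_cancel_left]
      rw [hzero, norm_zero]
      positivity
    · push Not at hyδ
      have hy' : y ∈ closedBall (0 : EuclideanSpace ℝ (Fin 3)) R' := ball_subset_closedBall hy
      calc ‖u t y‖ = ‖g y‖ := rfl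
        _ ≤ M := (hC₀ y hy').trans (le_max_left _ _)
        _ = M / δ ^ k * δ ^ k := by field_simp
        _ ≤ M / δ ^ k * (‖y‖ + Real.sqrt t) ^ k := by
          gcongr
          exact hyδ.trans (le_add_of_nonneg_right (Real.sqrt_nonneg t))
  -- apply ESS Thm 4.1 (tree, proved)
  have hconc := ess_unique_continuation_holds m R' 1 hR' one_pos u 0 H1 H2 H3 H4 H5 (x - a)
    (by rwa [mem_ball_zero_iff, ← dist_eq_norm])
  simpa [hu_def, hg_def] using hconc

/-- **Identity theorem for harmonic functions on a connected open set** (open–closed argument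
over `eqOn_zero_ball_of_laplacian_eq_zero`): `f` of class `C²` with `Δ f = 0` on an open
preconnected `U ⊆ ℝ³`, vanishing in a neighbourhood of one point of `U`, vanishes on `U`.
[cite: AxlerBourdonRamey2001, Thm 1.27] -/
theorem eqOn_zero_of_laplacian_eq_zero_of_isPreconnected
    {f : EuclideanSpace ℝ (Fin 3) → EuclideanSpace ℝ (Fin m)} {U : Set (EuclideanSpace ℝ (Fin 3))}
    (hU : IsOpen U) (hconn : IsPreconnected U) (hf : ContDiffOn ℝ 2 f U)
    (hΔ : ∀ x ∈ U, (Δ f) x = 0) {a : EuclideanSpace ℝ (Fin 3)} (ha : a ∈ U)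
    (h0 : f =ᶠ[𝓝 a] 0) : EqOn f 0 U := by
  -- the flat set `A = {x | f = 0 near x}` is open …
  have hAopen : IsOpen {x : EuclideanSpace ℝ (Fin 3) | f =ᶠ[𝓝 x] 0} := by
    simp only [Filter.EventuallyEq]
    exact isOpen_setOf_eventually_nhds
  -- … and relatively closed in `U` (harmonic unique continuation on balls)
  have hclos : ∀ x ∈ U, x ∈ closure {x : EuclideanSpace ℝ (Fin 3) | f =ᶠ[𝓝 x] 0} →
      f =ᶠ[𝓝 x] 0 := by
    intro x hxU hxcl
    obtain ⟨ε, hε, hballU⟩ := Metric.isOpen_iff.1 hU x hxU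
    obtain ⟨a', ha'A, hxa'⟩ := Metric.mem_closure_iff.1 hxcl (ε / 3) (by positivity)
    rw [mem_setOf_eq] at ha'A
    obtain ⟨δ₀, hδ₀, hδ₀ball⟩ := Metric.eventually_nhds_iff.1 ha'A
    -- the ball `B(a', 2ε/3) ⊆ B(x, ε) ⊆ U`
    have hsub : ball a' (2 * ε / 3) ⊆ U := by
      refine Subset.trans (fun y hy => ?_) hballU
      rw [mem_ball] at hy ⊢
      calc dist y x ≤ dist y a' + dist a' x := dist_triangle _ _ _
        _ < 2 * ε / 3 + ε / 3 := add_lt_add hy (by rwa [dist_comm] at hxa')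
        _ = ε := by ring
    have hzero : ∀ y ∈ ball a' (2 * ε / 3), f y = 0 :=
      eqOn_zero_ball_of_laplacian_eq_zero (hf.mono hsub) (fun y hy => hΔ y (hsub hy)) hδ₀
        (fun y hy => by simpa using hδ₀ball (mem_ball.1 hy))
    -- hence `f = 0` near `x` (`B(x, ε/3) ⊆ B(a', 2ε/3)`)
    have hxball : ball x (ε / 3) ⊆ ball a' (2 * ε / 3) := by
      intro y hy
      rw [mem_ball] at hy ⊢
      calc dist y a' ≤ dist y x + dist x a' := dist_triangle _ _ _
        _ < ε / 3 + ε / 3 := add_lt_add hy hxa'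
        _ = 2 * ε / 3 := by ring
    filter_upwards [isOpen_ball.mem_nhds (mem_ball_self (by positivity : (0 : ℝ) < ε / 3))]
      with y hy
    simpa using hzero y (hxball hy)
  -- connectedness of `U`
  have hUA : U ⊆ {x : EuclideanSpace ℝ (Fin 3) | f =ᶠ[𝓝 x] 0} := by
    refine hconn.subset_left_of_subset_union hAopen isClosed_closure.isOpen_compl
      (Set.disjoint_compl_right_iff_subset.2 subset_closure) (fun x hx => ?_) ⟨a, ha, h0⟩
    by_cases hxcl : x ∈ closure {x : EuclideanSpace ℝ (Fin 3) | f =ᶠ[𝓝 x] 0}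
    · exact Or.inl (hclos x hx hxcl)
    · exact Or.inr hxcl
  intro x hx
  have hx' : f =ᶠ[𝓝 x] 0 := hUA hx
  simpa using hx'.eq_of_nhds

end HUC

/-! ## Lebesgue nullity of `ℋ¹`-null sets in `ℝ³` -/

/-- An `ℋ¹`-null subset of `ℝ³` is Lebesgue-null (`μH[3] ≤ μH[1]`, and Lebesgue measure is
absolutely continuous with respect to the Haar measure `μH[3]`). [folklore] -/
theorem volume_eq_zero_of_hausdorffMeasure_one_eq_zero {S : Set (EuclideanSpace ℝ (Fin 3))}
    (hnull : μH[1] S = 0) : volume S = 0 := by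
  have h3 : μH[((3 : ℕ) : ℝ)] S = 0 :=
    nonpos_iff_eq_zero.1 ((Measure.hausdorffMeasure_mono (by norm_num) S).trans hnull.le)
  haveI : (μH[((3 : ℕ) : ℝ)] : Measure (EuclideanSpace ℝ (Fin 3))).IsAddHaarMeasure := by
    have h := isAddHaarMeasure_hausdorffMeasure (E := EuclideanSpace ℝ (Fin 3))
    rwa [finrank_euclideanSpace_fin] at h
  exact Measure.absolutelyContinuous_isAddHaarMeasure (volume : Measure (EuclideanSpace ℝ (Fin 3)))
    (μH[((3 : ℕ) : ℝ)]) h3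

/-- Points outside an `ℋ¹`-null set of `ℝ³` are Lebesgue-almost all points. [folklore] -/
theorem ae_mem_compl_of_hausdorffMeasure_one_eq_zero {S : Set (EuclideanSpace ℝ (Fin 3))}
    (hnull : μH[1] S = 0) : ∀ᵐ x ∂(volume : Measure (EuclideanSpace ℝ (Fin 3))), x ∈ Sᶜ :=
  compl_mem_ae_iff.2 (volume_eq_zero_of_hausdorffMeasure_one_eq_zero hnull)

/-! ## The D₁-facing forms: harmonic off a closed `ℋ¹`-null set and dark on a ball ⟹ zero -/

section DarkBall

/-- **Brick B6′.** Let `Σ ⊆ ℝ³` be closed with `ℋ¹(Σ) = 0`, and let `w : ℝ³ → ℝᵐ` be `C²` with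
`Δ w = 0` on `Σᶜ`. If `w = 0` a.e. on `B(x₀, ρ) ∖ Σ` for some ball, then `w = 0` on all of `Σᶜ`
(B5: `Σᶜ` is connected; harmonic unique continuation). [this file] -/
theorem eqOn_zero_compl_of_laplacian_eq_zero_of_darkBall {m : ℕ}
    {S : Set (EuclideanSpace ℝ (Fin 3))} (hS : IsClosed S) (hnull : μH[1] S = 0)
    {w : EuclideanSpace ℝ (Fin 3) → EuclideanSpace ℝ (Fin m)} (hw : ContDiffOn ℝ 2 w Sᶜ)
    (hΔ : ∀ x ∈ Sᶜ, (Δ w) x = 0) {x₀ : EuclideanSpace ℝ (Fin 3)} {ρ : ℝ} (hρ : 0 < ρ)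
    (hdark : ∀ᵐ x ∂(volume.restrict (ball x₀ ρ ∩ Sᶜ)), w x = 0) : EqOn w 0 Sᶜ := by
  -- the dark open set `V = B(x₀, ρ) ∖ Σ` is nonempty
  set V : Set (EuclideanSpace ℝ (Fin 3)) := ball x₀ ρ ∩ Sᶜ with hV_def
  have hVopen : IsOpen V := isOpen_ball.inter hS.isOpen_compl
  have hVne : V.Nonempty := by
    by_contra hVe
    rw [Set.not_nonempty_iff_eq_empty] at hVe
    have hsub : ball x₀ ρ ⊆ S := by
      intro y hy
      by_contra hyS
      have : y ∈ V := ⟨hy, hyS⟩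
      rw [hVe] at this
      exact this
    have hpos : 0 < volume (ball x₀ ρ) := measure_ball_pos volume x₀ hρ
    exact hpos.ne' (measure_mono_null hsub (volume_eq_zero_of_hausdorffMeasure_one_eq_zero hnull))
  obtain ⟨a, haV⟩ := hVne
  -- `w = 0` on `V` (continuous and a.e. zero on an open set)
  have hwV : EqOn w 0 V :=
    Measure.eqOn_open_of_ae_eq hdark hVopen (hw.continuousOn.mono inter_subset_right)
      continuousOn_const
  have h0 : w =ᶠ[𝓝 a] 0 :=
    Filter.eventuallyEq_of_mem (hVopen.mem_nhds haV) hwV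
  exact eqOn_zero_of_laplacian_eq_zero_of_isPreconnected hS.isOpen_compl
    (isPathConnected_compl_of_hausdorffMeasure_eq_zero hS hnull).isConnected.isPreconnected
    hw hΔ haV.2 h0

/-- **Brick B6′, a.e. form.** Under the hypotheses of
`eqOn_zero_compl_of_laplacian_eq_zero_of_darkBall`, `w = 0` Lebesgue-a.e. on `ℝ³`
(`Σ` is Lebesgue-null). [this file] -/
theorem ae_eq_zero_of_laplacian_eq_zero_off_closed_null_of_darkBall {m : ℕ}
    {S : Set (EuclideanSpace ℝ (Fin 3))} (hS : IsClosed S) (hnull : μH[1] S = 0)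
    {w : EuclideanSpace ℝ (Fin 3) → EuclideanSpace ℝ (Fin m)} (hw : ContDiffOn ℝ 2 w Sᶜ)
    (hΔ : ∀ x ∈ Sᶜ, (Δ w) x = 0) {x₀ : EuclideanSpace ℝ (Fin 3)} {ρ : ℝ} (hρ : 0 < ρ)
    (hdark : ∀ᵐ x ∂(volume.restrict (ball x₀ ρ ∩ Sᶜ)), w x = 0) :
    ∀ᵐ x ∂(volume : Measure (EuclideanSpace ℝ (Fin 3))), w x = 0 := by
  have h := eqOn_zero_compl_of_laplacian_eq_zero_of_darkBall hS hnull hw hΔ hρ hdark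
  filter_upwards [ae_mem_compl_of_hausdorffMeasure_one_eq_zero hnull] with x hx
  exact h hx

/-- **Brick B6′ for an a.e.-representative** (the D₁ slice `v = u T`, equal a.e. off `Σ` to the
harmonic field `w`): `Σ` closed `ℋ¹`-null, `w` of class `C²` with `Δ w = 0` on `Σᶜ`, `v = w` a.e.
on `Σᶜ`, and `v = 0` a.e. on a ball `B(x₀, ρ)` ⟹ `v = 0` a.e. on `ℝ³`. [this file] -/
theorem ae_eq_zero_of_ae_eq_harmonic_off_closed_null_of_darkBall {m : ℕ}
    {S : Set (EuclideanSpace ℝ (Fin 3))} (hS : IsClosed S) (hnull : μH[1] S = 0)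
    {v w : EuclideanSpace ℝ (Fin 3) → EuclideanSpace ℝ (Fin m)} (hw : ContDiffOn ℝ 2 w Sᶜ)
    (hΔ : ∀ x ∈ Sᶜ, (Δ w) x = 0) (hvw : ∀ᵐ x ∂(volume.restrict Sᶜ), v x = w x)
    {x₀ : EuclideanSpace ℝ (Fin 3)} {ρ : ℝ} (hρ : 0 < ρ)
    (hdark : ∀ᵐ x ∂(volume.restrict (ball x₀ ρ)), v x = 0) :
    ∀ᵐ x ∂(volume : Measure (EuclideanSpace ℝ (Fin 3))), v x = 0 := by
  -- `w = 0` a.e. on `B(x₀, ρ) ∖ Σ`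
  have h1 : ∀ᵐ x ∂(volume.restrict (ball x₀ ρ ∩ Sᶜ)), v x = w x :=
    ae_restrict_of_ae_restrict_of_subset inter_subset_right hvw
  have h2 : ∀ᵐ x ∂(volume.restrict (ball x₀ ρ ∩ Sᶜ)), v x = 0 :=
    ae_restrict_of_ae_restrict_of_subset inter_subset_left hdark
  have hdarkw : ∀ᵐ x ∂(volume.restrict (ball x₀ ρ ∩ Sᶜ)), w x = 0 := by
    filter_upwards [h1, h2] with x hx1 hx2
    rw [← hx1, hx2]
  have hw0 := eqOn_zero_compl_of_laplacian_eq_zero_of_darkBall hS hnull hw hΔ hρ hdarkw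
  -- `volume.restrict Σᶜ = volume` since `Σ` is null
  have hrestr : (volume : Measure (EuclideanSpace ℝ (Fin 3))).restrict Sᶜ = volume :=
    Measure.restrict_eq_self_of_ae_mem (ae_mem_compl_of_hausdorffMeasure_one_eq_zero hnull)
  rw [hrestr] at hvw
  filter_upwards [hvw, ae_mem_compl_of_hausdorffMeasure_one_eq_zero hnull] with x hx hxS
  rw [hx]
  exact hw0 hxS

/-- **Brick B6′ on the backward-singular slice.** For any velocity field `u`, time `t`, with
`Σ_t = {x | IsBackwardSingularPoint u (t, x)}` (closed, `isClosed_backwardSingularSlice`) of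
`ℋ¹`-measure zero (brick B0 for the terminal slice of the Clay-class solutions of D₁): if the slice
`v` agrees a.e. off `Σ_t` with a field `w` of class `C²` and harmonic on `Σ_tᶜ`, and `v = 0` a.e. on
a ball, then `v = 0` a.e. on `ℝ³`. [this file] -/
theorem ae_eq_zero_of_ae_eq_harmonic_off_backwardSingularSlice_of_darkBall
    (u : ℝ → (EuclideanSpace ℝ (Fin 3)) → (EuclideanSpace ℝ (Fin 3))) (t : ℝ)
    (hnull : μH[1] {x : EuclideanSpace ℝ (Fin 3) | IsBackwardSingularPoint u (t, x)} = 0)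
    {v w : EuclideanSpace ℝ (Fin 3) → EuclideanSpace ℝ (Fin 3)}
    (hw : ContDiffOn ℝ 2 w {x : EuclideanSpace ℝ (Fin 3) | IsBackwardSingularPoint u (t, x)}ᶜ)
    (hΔ : ∀ x ∈ {x : EuclideanSpace ℝ (Fin 3) | IsBackwardSingularPoint u (t, x)}ᶜ, (Δ w) x = 0)
    (hvw : ∀ᵐ x ∂(volume.restrict {x : EuclideanSpace ℝ (Fin 3) | IsBackwardSingularPoint u (t, x)}ᶜ),
      v x = w x)
    {x₀ : EuclideanSpace ℝ (Fin 3)} {ρ : ℝ} (hρ : 0 < ρ)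
    (hdark : ∀ᵐ x ∂(volume.restrict (ball x₀ ρ)), v x = 0) :
    ∀ᵐ x ∂(volume : Measure (EuclideanSpace ℝ (Fin 3))), v x = 0 :=
  ae_eq_zero_of_ae_eq_harmonic_off_closed_null_of_darkBall (isClosed_backwardSingularSlice u t)
    hnull hw hΔ hvw hρ hdark

end DarkBall

end Summit.NavierStokesRegularity.NavierStokesRegularity.Theorems
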